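import Literature.Computability.AlgebraicComplexity.KoiranCriterion
import HarnessLib

set_option linter.dupNamespace false

/-!
# Stub `stub_transferWitness` — the SIGNED two-block Koiran witness at explicit granularity

Crux `TauBurgisserDet` (item `stmt-ValiantsHypothesis-7680`), line `registered`. Bürgisser 2009,
Thm. 2.11 (= Koiran 2004, Thm. 6.1, the generalized Valiant criterion), as applied in the proof of
Thm. 4.1(2) (ECCC TR06-113, p. 14–15), re-run with an explicit size/degree budget and for the
DIFFERENCE of two 0/1 arrays: for digit counts `ℓ = bitLen (p n)`, `μ = bitLen (q n)`, a block size
`M` and two `B₂`-circuit families `CF⁺, CF⁻` of size `≤ M` at all query lengths `≤ 8 (ℓ + μ) + 9`,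
there is ONE fan-in-two sign-constant (constant-free) circuit `P` over
`KoiranVars ℓ μ ⊕ Fin (ℓ + μ + M + 1)` of size `≤ 160 (ℓ + μ + M + 1)^5 + 6` and formal degree
`≤ 6 (ℓ + μ + M) + 15` whose Boolean sum becomes, under Bürgisser's substitution `blockSubst p q n`,
`B⁺_n - B⁻_n`, the difference of the two-block interpolating polynomials (`twoBlockPoly`) of the
arrays decided by `CF⁺` and `CF⁻` through the query words `encBitQuery n k j true`.

Proof. With the tree's one-array witness `KoiranW.gK π` (`KoiranCriterionWitness.lean`) at the two
parameter sets `π± = ⟨ℓ, μ, M, CF±, …⟩` (same variable type `KoiranVars ℓ μ ⊕ BV`,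
`BV = Fin ℓ ⊕ (Fin μ ⊕ Fin M)`), put one more Boolean variable `t` and

  `gS = t · gK π⁺ - (1 - t) · gK π⁻`  over `KoiranVars ℓ μ ⊕ (BV ⊕ Unit)`.

* `(size, formal degree)`: `HasTauDeg gS (gKSize π⁺ + gKSize π⁻ + 6) (max (gKDeg π⁺) (gKDeg π⁻) + 1)`
  by the calculus of `ConstantFreeDegree.lean`, then `gKSize_le`, `gKDeg_le` (`KoiranCriterion.lean`)
  and a renaming of the Boolean block by `Fin (ℓ + μ + M + 1)` (`DefVNP.boolSum_rename_equiv`);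
* the Boolean sum splits over the selector bit: `∑_e gS = ∑_e gK π⁺ - ∑_e gK π⁻`
  (`tbw_bsum_signed`);
* each summand is handled by `KoiranW.aeval_bsubN_bsum_gK` and the range restriction of
  `KoiranW.KData.aeval_blockSubst_G` (`tbw_aeval_blockSubst_bsum_gK`).

## References

* [Burgisser2006]/[Burgisser2009] P. Bürgisser, *On defining integers and proving arithmetic
  circuit lower bounds*, ECCC TR06-113 = Comput. Complexity 18 (2009) 81–103, Thm. 2.11, proof of
  Thm. 4.1(2) (p. 14–15), §2.2 (formal degree), Def. 2.7–2.8 (`VP⁰`, `VNP⁰`).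
* [Koiran2004] P. Koiran, *Valiant's model and the cost of computing integers*, Comput.
  Complexity 13 (2004) 131–146, Thm. 6.1.
* [Burgisser2000] P. Bürgisser, *Completeness and Reduction in Algebraic Complexity Theory*,
  Springer 2000, Def. 2.5 (Boolean sums), Prop. 2.20 (Valiant's criterion).
-/

noncomputable section

open MvPolynomial

namespace Summit.ValiantsHypothesis.ValiantsHypothesis.Theorems.IntegralOrbitsTauBurgisserDet

open Literature.Computability.AlgebraicComplexity Literature.Computability.Complexity
open CircuitArith KoiranW

/-! ### The signed combination of two polynomials over a common Boolean block -/

section Signed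

variable {σ β : Type*}

/-- The Boolean substitution of an assignment of `β ⊕ Unit`, pulled back along the embedding
`σ ⊕ β → σ ⊕ (β ⊕ Unit)`, is the Boolean substitution of the restricted assignment. [folklore] -/
theorem tbw_φb_comp_map (e : β ⊕ Unit → Bool) :
    (DefVNP.φb (k := ℤ) (σ := σ) e) ∘ Sum.map id Sum.inl = DefVNP.φb (k := ℤ) (e ∘ Sum.inl) := by
  funext v
  rcases v with i | b <;> rfl

/-- Summing over the assignments of `β ⊕ Unit` is summing over the assignments of `β` and the two
values of the extra bit. [folklore] -/
theorem tbw_sum_assign_sumUnit [Fintype β] [DecidableEq β] {A : Type*} [AddCommMonoid A]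
    (F : (β ⊕ Unit → Bool) → A) :
    ∑ e, F e = ∑ e' : β → Bool, (F (Sum.elim e' fun _ => true) + F (Sum.elim e' fun _ => false)) := by
  rw [← Fintype.sum_equiv (Equiv.sumArrowEquivProdArrow β Unit Bool).symm
      (fun t => F ((Equiv.sumArrowEquivProdArrow β Unit Bool).symm t)) F (fun _ => rfl),
    Fintype.sum_prod_type]
  refine Finset.sum_congr rfl fun e' _ => ?_
  rw [Fintype.sum_equiv (Equiv.funUnique Unit Bool)
      (fun y => F ((Equiv.sumArrowEquivProdArrow β Unit Bool).symm (e', y)))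
      (fun b => F (Sum.elim e' fun _ => b)) (fun y => ?_), Fintype.sum_bool]
  change F (Sum.elim e' y) = F (Sum.elim e' fun _ => y ())
  rfl

/-- **The Boolean sum of the signed combination splits over the selector bit**: with a fresh
Boolean variable `t`, `∑_{e, t} (t · G₁(e) - (1 - t) · G₂(e)) = ∑_e G₁(e) - ∑_e G₂(e)`
(`t = 1` contributes `G₁`, `t = 0` contributes `-G₂`). [cite: Burgisser2000, Def. 2.5] -/
theorem tbw_bsum_signed [Fintype β] [DecidableEq β] (G₁ G₂ : MvPolynomial (σ ⊕ β) ℤ) :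
    DefVNP.bsum (X (Sum.inr (Sum.inr ())) * rename (Sum.map id Sum.inl) G₁ -
        (1 - X (Sum.inr (Sum.inr ()))) * rename (Sum.map id Sum.inl) G₂ :
          MvPolynomial (σ ⊕ (β ⊕ Unit)) ℤ) =
      DefVNP.bsum G₁ - DefVNP.bsum G₂ := by
  unfold DefVNP.bsum
  have h : ∀ e : β ⊕ Unit → Bool,
      aeval (DefVNP.φb (k := ℤ) e) (X (Sum.inr (Sum.inr ())) * rename (Sum.map id Sum.inl) G₁ -
        (1 - X (Sum.inr (Sum.inr ()))) * rename (Sum.map id Sum.inl) G₂ :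
          MvPolynomial (σ ⊕ (β ⊕ Unit)) ℤ) =
      C (toK ℤ (e (Sum.inr ()))) * aeval (DefVNP.φb (k := ℤ) (e ∘ Sum.inl)) G₁ -
        (1 - C (toK ℤ (e (Sum.inr ())))) * aeval (DefVNP.φb (k := ℤ) (e ∘ Sum.inl)) G₂ := by
    intro e
    rw [map_sub, map_mul, map_mul, map_sub, map_one, aeval_X, aeval_rename, aeval_rename,
      tbw_φb_comp_map]
    rfl
  simp only [h]
  rw [tbw_sum_assign_sumUnit]
  simp only [Sum.elim_comp_inl, Sum.elim_inr, toK_true, toK_false, C_1, C_0, one_mul, sub_self,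
    zero_mul, sub_zero, zero_sub, ← sub_eq_add_neg, Finset.sum_sub_distrib]

/-- **`(size, formal degree)` of the signed combination**: from `(s₁, d₁)`, `(s₂, d₂)` to
`(s₁ + s₂ + 6, max d₁ d₂ + 1)` — one product with `t`, one with `1 - t`, one difference
(Bürgisser 2009, §2.2). [cite: Burgisser2006, §2.2] -/
theorem tbw_hasTauDeg_signed {G₁ G₂ : MvPolynomial (σ ⊕ β) ℤ} {s₁ d₁ s₂ d₂ : ℕ}
    (h₁ : HasTauDeg G₁ s₁ d₁) (h₂ : HasTauDeg G₂ s₂ d₂) :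
    HasTauDeg (X (Sum.inr (Sum.inr ())) * rename (Sum.map id Sum.inl) G₁ -
        (1 - X (Sum.inr (Sum.inr ()))) * rename (Sum.map id Sum.inl) G₂ :
          MvPolynomial (σ ⊕ (β ⊕ Unit)) ℤ) (s₁ + s₂ + 6) (max d₁ d₂ + 1) := by
  have hX : HasTauDeg (X (Sum.inr (Sum.inr ())) : MvPolynomial (σ ⊕ (β ⊕ Unit)) ℤ) 0 1 :=
    HasTauDeg.X _
  have h := (hX.mul (h₁.rename (Sum.map id Sum.inl))).sub
    (hX.one_sub.mul (h₂.rename (Sum.map id Sum.inl)))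
  refine h.mono (by omega) ?_
  rw [max_self]
  omega

/-- The enumerated Boolean block has `ℓ + μ + M + 1` elements. [folklore] -/
theorem tbw_card_block (ℓ μ M : ℕ) :
    Fintype.card ((Fin ℓ ⊕ (Fin μ ⊕ Fin M)) ⊕ Unit) = ℓ + μ + M + 1 := by
  simp only [Fintype.card_sum, Fintype.card_fin, Fintype.card_unit]
  omega

end Signed

/-! ### One array: the substitution identity at explicit parameters -/

section OneArray

variable (p q : ℕ → ℕ) (n M : ℕ) (CF : CircuitFamily) (har : ∀ m, (CF m).IsOver B2)
  (hM : ∀ m, m ≤ 8 * (bitLen (p n) + bitLen (q n)) + 9 → (CF m).size ≤ M)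

/-- `blockSubst p q n` is the digit substitution `bsubN` of the member `(bitLen (p n), bitLen (q n))`
(as `KoiranW.KData.blockSubst_eq_bsubN`, for explicit parameters). [cite: Burgisser2006, proof of Thm. 4.1(2)] -/
theorem tbw_blockSubst_eq_bsubN :
    blockSubst p q n = bsubN ⟨bitLen (p n), bitLen (q n), M, CF, har, hM⟩ n (p n) (q n) := by
  funext v
  rcases v with yz | i | i | i
  · rfl
  · change C (((n.testBit i).toNat : ℤ)) = C (toK ℤ (n.testBit i))
    cases n.testBit i <;> rfl
  · change C ((((p n).testBit i).toNat : ℤ)) = C (toK ℤ ((p n).testBit i))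
    cases (p n).testBit i <;> rfl
  · change C ((((q n).testBit i).toNat : ℤ)) = C (toK ℤ ((q n).testBit i))
    cases (q n).testBit i <;> rfl

/-- **The substitution identity for one array** (Bürgisser 2009, proof of Thm. 4.1(2) via
Thm. 2.11 = Koiran 2004, Thm. 6.1): under `blockSubst p q n` the Boolean sum of the witness
`gK ⟨bitLen (p n), bitLen (q n), M, CF, …⟩` is the two-block polynomial of the array
`b(n', k, j) = C(encBitQuery n' k j true)` read off the circuits (as `KoiranW.KData.aeval_blockSubst_G`,
with the membership function `x ↦ C_{|x|}(x)` itself, so that the decision hypothesis is `rfl`). [cite: Burgisser2006, proof of Thm. 4.1(2), p. 14–15] -/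
theorem tbw_aeval_blockSubst_bsum_gK (hpn : n ≤ p n) :
    aeval (blockSubst p q n) (DefVNP.bsum (gK ⟨bitLen (p n), bitLen (q n), M, CF, har, hM⟩)) =
      twoBlockPoly p q
        (fun n' k j => (CF (encBitQuery n' k j true).length).eval (encBitQuery n' k j true).get) n := by
  have hP : p n < 2 ^ bitLen (p n) := lt_two_pow_bitLen (p n)
  have hQ : q n < 2 ^ bitLen (q n) := lt_two_pow_bitLen (q n)
  have hn : n < 2 ^ (bitLen (p n) + bitLen (q n)) :=
    (lt_of_le_of_lt hpn hP).trans_le (Nat.pow_le_pow_right (by norm_num) (Nat.le_add_right _ _))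
  rw [tbw_blockSubst_eq_bsubN p q n M CF har hM,
    aeval_bsubN_bsum_gK ⟨bitLen (p n), bitLen (q n), M, CF, har, hM⟩ (p n) (q n) hn hP hQ
      (fun x => (CF x.length).eval x.get) (fun _ => rfl), twoBlockPoly]
  -- restrict the ranges
  rw [DefVNP.sum_range_of_eq_zero (Nat.succ_le_of_lt hP)]
  · refine Finset.sum_congr rfl fun j hj => ?_
    have hj' : j ≤ p n := Nat.lt_succ_iff.1 (Finset.mem_range.1 hj)
    rw [DefVNP.sum_range_of_eq_zero (Nat.succ_le_of_lt hQ)]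
    · refine Finset.sum_congr rfl fun k hk => ?_
      have hk' : k ≤ q n := Nat.lt_succ_iff.1 (Finset.mem_range.1 hk)
      rw [decide_eq_true hj', decide_eq_true hk', toK_true, one_mul, one_mul]
      by_cases hb : (CF (encBitQuery n k j true).length).eval (encBitQuery n k j true).get = true
      · rw [hb, toK_true, C_1, one_mul, if_pos rfl]
      · rw [if_neg hb, Bool.eq_false_iff.2 hb, toK_false, C_0, zero_mul]
    · intro k hk
      rw [decide_eq_false (by omega : ¬ k ≤ q n)]; simp [toK]
  · intro j hj
    refine Finset.sum_eq_zero fun k _ => ?_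
    rw [decide_eq_false (by omega : ¬ j ≤ p n)]; simp [toK]

/-- The one-array witness at explicit parameters has a constant-free circuit of size
`≤ 80 (ℓ + μ + M + 1)^5` and formal degree `≤ 6 (ℓ + μ + M) + 14` (`hasTauDeg_gK`, `gKSize_le`,
`gKDeg_le`). [cite: Burgisser2006, Def. 2.7] -/
theorem tbw_hasTauDeg_gK :
    HasTauDeg (gK ⟨bitLen (p n), bitLen (q n), M, CF, har, hM⟩)
      (80 * (bitLen (p n) + bitLen (q n) + M + 1) ^ 5) (6 * (bitLen (p n) + bitLen (q n) + M) + 14) :=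
  (hasTauDeg_gK _).mono (gKSize_le _) (gKDeg_le _)

end OneArray

/-! ### The stub -/

/-- **Stub 3a — the SIGNED two-block Koiran witness at explicit granularity** (Bürgisser 2009,
Thm. 2.11 = Koiran 2004, Thm. 6.1, re-run): for digit counts `ℓ = bitLen (p n)`, `μ = bitLen (q n)`,
a block size `M` and two `B₂`-circuit families `CF⁺, CF⁻` of size `≤ M` at all query lengths
`≤ 8 (ℓ + μ) + 9`, ONE fan-in-two sign-constant circuit `P` over `KoiranVars ℓ μ ⊕ Fin (ℓ + μ + M + 1)`
of size `≤ 160 (ℓ + μ + M + 1)^5 + 6` and formal degree `≤ 6 (ℓ + μ + M) + 15` whose Boolean sum, under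
`blockSubst p q n`, is the DIFFERENCE of the two-block polynomials of the arrays decided by `CF⁺`
and `CF⁻`. The witness is `t · gK π⁺ - (1 - t) · gK π⁻` over the common Boolean block with one
selector bit `t`, enumerated by `Fin (ℓ + μ + M + 1)`. [cite: Burgisser2006, Thm. 2.11 and proof of Thm. 4.1(2)] [cite: Koiran2004, Thm. 6.1] -/
theorem stub_transferWitness :
    ∀ (p q : ℕ → ℕ) (n M : ℕ) (CFp CFm : Literature.Computability.Complexity.CircuitFamily),
      n ≤ p n →
      (∀ m, (CFp m).IsOver Literature.Computability.Complexity.B2) → (∀ m, (CFm m).IsOver Literature.Computability.Complexity.B2) →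
      (∀ m, m ≤ 8 * (Literature.Computability.AlgebraicComplexity.bitLen (p n) + Literature.Computability.AlgebraicComplexity.bitLen (q n)) + 9 → (CFp m).size ≤ M) →
      (∀ m, m ≤ 8 * (Literature.Computability.AlgebraicComplexity.bitLen (p n) + Literature.Computability.AlgebraicComplexity.bitLen (q n)) + 9 → (CFm m).size ≤ M) →
      ∃ P : Literature.Computability.AlgebraicComplexity.ArithCircuit ℤ
          (Literature.Computability.AlgebraicComplexity.KoiranVars (Literature.Computability.AlgebraicComplexity.bitLen (p n)) (Literature.Computability.AlgebraicComplexity.bitLen (q n)) ⊕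
            Fin (Literature.Computability.AlgebraicComplexity.bitLen (p n) + Literature.Computability.AlgebraicComplexity.bitLen (q n) + M + 1)),
        P.IsFanInTwo ∧ P.HasSignConstants ∧
        P.size ≤ 160 * (Literature.Computability.AlgebraicComplexity.bitLen (p n) + Literature.Computability.AlgebraicComplexity.bitLen (q n) + M + 1) ^ 5 + 6 ∧
        P.formalDegree ≤ 6 * (Literature.Computability.AlgebraicComplexity.bitLen (p n) + Literature.Computability.AlgebraicComplexity.bitLen (q n) + M) + 15 ∧
        MvPolynomial.aeval (Literature.Computability.AlgebraicComplexity.blockSubst p q n) (Literature.Computability.AlgebraicComplexity.boolSum P.eval) =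
          Literature.Computability.AlgebraicComplexity.twoBlockPoly p q
              (fun n' k j => (CFp (Literature.Computability.AlgebraicComplexity.encBitQuery n' k j true).length).eval
                (Literature.Computability.AlgebraicComplexity.encBitQuery n' k j true).get) n -
            Literature.Computability.AlgebraicComplexity.twoBlockPoly p q
              (fun n' k j => (CFm (Literature.Computability.AlgebraicComplexity.encBitQuery n' k j true).length).eval
                (Literature.Computability.AlgebraicComplexity.encBitQuery n' k j true).get) n := by
  intro p q n M CFp CFm hpn harp harm hMp hMm
  -- the enumeration of the common Boolean block with the selector bit
  have ε : (Fin (bitLen (p n)) ⊕ (Fin (bitLen (q n)) ⊕ Fin M)) ⊕ Unit ≃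
      Fin (bitLen (p n) + bitLen (q n) + M + 1) :=
    Fintype.equivFinOfCardEq (tbw_card_block _ _ _)
  -- the signed witness and its circuit
  have hS := ((tbw_hasTauDeg_signed (tbw_hasTauDeg_gK p q n M CFp harp hMp)
    (tbw_hasTauDeg_gK p q n M CFm harm hMm)).rename (Sum.map id ε)).mono
    (s' := 160 * (bitLen (p n) + bitLen (q n) + M + 1) ^ 5 + 6)
    (d' := 6 * (bitLen (p n) + bitLen (q n) + M) + 15) (by omega) (by rw [max_self])
  obtain ⟨P, h1, h2, h3, h4, h5⟩ := hS
  refine ⟨P, h1, h2, h4, h5, ?_⟩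
  rw [h3, DefVNP.boolSum_rename_equiv, tbw_bsum_signed, map_sub,
    tbw_aeval_blockSubst_bsum_gK p q n M CFp harp hMp hpn,
    tbw_aeval_blockSubst_bsum_gK p q n M CFm harm hMm hpn]

end Summit.ValiantsHypothesis.ValiantsHypothesis.Theorems.IntegralOrbitsTauBurgisserDet

end
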